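import Mathlib
import Summits.Ventures.HodgeRepro.Tier4.Common.KTypeSpace
import Summits.Ventures.HodgeRepro.Tier4.Common.SettingOfData
import Summits.Ventures.HodgeRepro.Tier4.Line1.SpectralOfRTF
import Summits.Ventures.HodgeRepro.Tier4.Line1.InnerCalculus
import Summits.Ventures.HodgeRepro.Tier4.Line4.W4SpectralBridge
import Summits.Ventures.HodgeRepro.Tier4.Line4.W3Reduction2
import Summits.Ventures.HodgeRepro.Tier4.Line4.W3TwoVector

/-!
# Tier4/Line4/W3TwoVectorDirect — the two-vector wall W3⁗ in the DIRECT shape: the vectors `R(f̄₁) φ_j`, `R(f₂ˇ) φ_j`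
themselves, in the ONB's own constituent `span (τ (n j))` (t4-crit-2 g4's clearing route (ii) of O-L4-2VEC-BIND-c2)

Blind re-derivation cell `pub-hodge-repro`, Tier 4 «prove the step» (README §9–§10), seat t4-L1-p5 (prover, gen 3;
cut C-L4-2VEC S13948 / S13950; this is the DIRECT-shape twin of `W3TwoVector` p687589 after t4-crit-2 g4's binding
objection S13987).  Tree path `lean/Summits/Ventures/HodgeRepro/Tier4/Line4/W3TwoVectorDirect.lean`.  Consumes
L1-p1's `SpectralOfRTF`, plan-1's `atoms`, t4-L1-p4's `kernel_cj` (InnerCalculus), t4-L4-p2's `Jc_eq_J` /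
`isCharacter_chi` / `isCharacter'_chi'`, t4-L1-p2's `conv_isTest`, typer-2's `periodLin_eq_integral` — by name.

WHAT IS PROVED.  `W3TwoVector` (p687589) hands over the CONJUGATES of `R(f̄₁) φ_j`, `R(f₂ˇ) φ_j` (the period
bridges of the setting's characters are conjugate-linear), so its stability clause lives in the conjugate
constituent family and cannot be discharged by L4-p2's `rightRegular_cj_projTest_mem`, which gives the DIRECT
shape `R(cj (projTest f)) φ ∈ kTypeSpace' … K V` (S13987).  Here the spectral expansion is run with the CONJUGATE
characters `conj χ`, `conj χ′` (characters of the setting again: `isCharacter_conj_chi`), for which the spectral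
term is `P_{χ′}(R(f₂ˇ) φ_j) · conj P_χ(R(f̄₁) φ_j)` with `P_χ = periodLin … R.chi` the wall's own period
(`periodLin_chi_eq_periodT_conj`, `periodLin_chi'_eq_periodT'_conj`); the price is that the RTF distribution of the
expansion is `J(conj χ, conj χ′)(f₁ ⋆ f₂) = conj Jc(f̄₁ ⋆ f̄₂)` (`J_conj_eq`, `conv_cj`), so the weak-W5 clause is asked
of the CONJUGATE pair: `hJ : Jc(f̄₁ ⋆ f̄₂) ≠ 0`.  `mixed_two_torus_W3_twoVector_direct`: from an adapted ONB, a
compact open `K`, the DIRECT stability `R(f̄₁) φ_j, R(f₂ˇ) φ_j ∈ kTypeSpace' … K (span (τ (n j)))`, admissibility of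
the hit constituents `span (τ m)` and `hJ` for the conjugate pair: the W3⁗ conclusion with `V₀ := span (τ (n j))`,
`K₀ := K`.  Both shapes are honest displays of the same content; the consumer picks the one its projector
discharges (CONJ shape ⇔ class `χ = weight′`; DIRECT shape ⇔ class `χ = conj weight′`).  Nothing of the wall's
content is proved: stability, `hadm`, `hJ` are displayed.

Nothing here says anything about the status of the Hodge conjecture for CM abelian varieties, which is NOT proved
(HC_CM is NOT proved by anyone in this repository).
-/

set_option autoImplicit false

noncomputable section

namespace Summit.Ventures.HodgeRepro.Tier4.Line4

open Summit.Ventures.HodgeRepro.Tier4.Common Summit.Ventures.HodgeRepro.Tier4.Line1 MeasureTheory NumberField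
open scoped ComplexConjugate

section ConjBridge

variable {k : Type} [Field k] [NumberField k] (W : PlaneData k) [MeasurableSpace (GA W)] [BorelSpace (GA W)]
  (R : RTFData W) (μ : Measure (GA W)) [μ.IsHaarMeasure] [R.μT.IsHaarMeasure] [R.μT'.IsHaarMeasure]
  (DG : Set (GA W)) (fdG : IsFundamentalDomain (rationalPoints W) DG μ) (compG : IsCompact (closure DG))
  (compT : IsCompact (closure R.DT)) (compT' : IsCompact (closure R.DT'))

/-- the conjugate of `R.chi` is a character of the setting. -/
theorem isCharacter_conj_chi (hc : Continuous R.chi) (hu : ∀ a, ‖R.chi a‖ = 1) :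
    (Setting.ofAdelicData W R μ DG fdG compG compT compT').IsCharacter (fun t => conj (R.chi t)) := by
  have h := isCharacter_chi W R μ DG fdG compG compT compT' hc hu
  refine ⟨Complex.continuous_conj.comp h.cont, fun a b => ?_, fun a => ?_, fun a ha => ?_⟩
  · rw [h.map_mul, map_mul]
  · rw [Complex.norm_conj]
    exact h.unit a
  · rw [h.rational a ha, map_one]

/-- the conjugate of `R.chi'` is a character of the setting. -/
theorem isCharacter'_conj_chi' (hc' : Continuous R.chi') (hu' : ∀ a, ‖R.chi' a‖ = 1) :
    (Setting.ofAdelicData W R μ DG fdG compG compT compT').IsCharacter' (fun t => conj (R.chi' t)) := by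
  have h := isCharacter'_chi' W R μ DG fdG compG compT compT' hc' hu'
  refine ⟨Complex.continuous_conj.comp h.cont, fun a b => ?_, fun a => ?_, fun a ha => ?_⟩
  · rw [h.map_mul, map_mul]
  · rw [Complex.norm_conj]
    exact h.unit a
  · rw [h.rational a ha, map_one]

/-- the convolution of the conjugates is the conjugate of the convolution. -/
theorem conv_cj (f₁ f₂ : GA W → ℂ) :
    (Setting.ofAdelicData W R μ DG fdG compG compT compT').conv (RTF.cj f₁) (RTF.cj f₂) =
      RTF.cj ((Setting.ofAdelicData W R μ DG fdG compG compT compT').conv f₁ f₂) := by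
  funext g
  simp only [RTF.Setting.conv, RTF.cj]
  rw [← integral_conj]
  refine integral_congr_ae (Filter.Eventually.of_forall fun h => ?_)
  simp only [map_mul]

/-- **the RTF distribution of the conjugate characters is the conjugate distribution of the conjugate test function**:
`J(conj χ, conj χ′)(f) = conj J(χ, χ′)(conj f)` (`kernel_cj`). -/
theorem J_conj_eq (f : GA W → ℂ) :
    (Setting.ofAdelicData W R μ DG fdG compG compT compT').J (fun t => conj (R.chi t)) (fun t => conj (R.chi' t)) f =
      conj ((Setting.ofAdelicData W R μ DG fdG compG compT compT').J R.chi R.chi' (RTF.cj f)) := by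
  unfold RTF.Setting.J
  rw [← integral_conj]
  refine integral_congr_ae (Filter.Eventually.of_forall fun t => ?_)
  beta_reduce
  rw [← integral_conj]
  refine integral_congr_ae (Filter.Eventually.of_forall fun t' => ?_)
  beta_reduce
  rw [(Setting.ofAdelicData W R μ DG fdG compG compT compT').kernel_cj]
  simp only [map_mul, Complex.conj_conj]

/-- **the wall's `T`-period is the setting's `T`-period for the conjugate character**:
`periodLin_χ(ψ|_T) = ∫_{D_T} ψ · conj (conj χ)` for continuous `ψ`. -/
theorem periodLin_chi_eq_periodT_conj (hc : Continuous R.chi) {ψ : GA W → ℂ} (hψ : Continuous ψ) :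
    periodLin W R.μT R.DT R.chi (restrictTo W (torusT W) ψ) =
      (Setting.ofAdelicData W R μ DG fdG compG compT compT').periodT (fun t => conj (R.chi t))
        (restrictTo W (torusT W) ψ) := by
  haveI : IsFiniteMeasureOnCompacts R.μT := (inferInstance : R.μT.IsHaarMeasure).toIsFiniteMeasureOnCompacts
  have hint : Integrable (fun t : torusT W => R.chi t * restrictTo W (torusT W) ψ t) (R.μT.restrict R.DT) := by
    refine integrableOn_of_continuous_of_isCompact_closure R.μT compT ?_
    exact hc.mul (hψ.comp continuous_subtype_val)
  unfold RTF.Setting.periodT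
  rw [periodLin_eq_integral W R.μT R.DT R.chi hint]
  refine integral_congr_ae (Filter.Eventually.of_forall fun t => ?_)
  simp only [restrictTo, Complex.conj_conj]
  ring

/-- **the wall's `T′`-period is the setting's `T′`-period for the conjugate character**. -/
theorem periodLin_chi'_eq_periodT'_conj (hc' : Continuous R.chi') {ψ : GA W → ℂ} (hψ : Continuous ψ) :
    periodLin W R.μT' R.DT' R.chi' (restrictTo W (torusT' W) ψ) =
      (Setting.ofAdelicData W R μ DG fdG compG compT compT').periodT' (fun t => conj (R.chi' t))
        (restrictTo W (torusT' W) ψ) := by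
  haveI : IsFiniteMeasureOnCompacts R.μT' := (inferInstance : R.μT'.IsHaarMeasure).toIsFiniteMeasureOnCompacts
  have hint : Integrable (fun t : torusT' W => R.chi' t * restrictTo W (torusT' W) ψ t)
      (R.μT'.restrict R.DT') := by
    refine integrableOn_of_continuous_of_isCompact_closure R.μT' compT' ?_
    exact hc'.mul (hψ.comp continuous_subtype_val)
  unfold RTF.Setting.periodT'
  rw [periodLin_eq_integral W R.μT' R.DT' R.chi' hint]
  refine integral_congr_ae (Filter.Eventually.of_forall fun t => ?_)
  simp only [restrictTo, Complex.conj_conj]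
  ring

end ConjBridge

section Wall

variable {k : Type} [Field k] [NumberField k] (W : PlaneData k) [MeasurableSpace (GA W)] [BorelSpace (GA W)]
  (R : RTFData W) (μ : Measure (GA W)) [μ.IsHaarMeasure] [R.μT.IsHaarMeasure] [R.μT'.IsHaarMeasure]
  (DG : Set (GA W)) (fdG : IsFundamentalDomain (rationalPoints W) DG μ) (compG : IsCompact (closure DG))
  (compT : IsCompact (closure R.DT)) (compT' : IsCompact (closure R.DT'))

/-- **THE TWO-VECTOR WALL W3⁗ IN THE DIRECT SHAPE**: from an adapted ONB of the setting, a compact open level `K`, the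
DIRECT stability `R(f̄₁) φ_j, R(f₂ˇ) φ_j ∈ kTypeSpace' … K (span (τ (n j)))`, admissibility of the hit constituents
`span (τ m)` and the weak W5 for the CONJUGATE pair `Jc(f̄₁ ⋆ f̄₂) ≠ 0`: some admissible `V₀ = span (τ (n j))` and
`K₀ = K` carry a vector of `kTypeSpace' … K₀ V₀` with non-zero `T′`-period and one with non-zero `T`-period
(the spectral expansion for the conjugate characters, whose terms are the wall's own periods). -/
theorem mixed_two_torus_W3_twoVector_direct (hc : Continuous R.chi) (hu : ∀ a, ‖R.chi a‖ = 1)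
    (hc' : Continuous R.chi') (hunit' : ∀ t, ‖R.chi' t‖ = 1)
    (q : QuadData k) (g g' : Matrix (Fin 4) (Fin 4) k) (w₀ : InfinitePlace k)
    (eP eM eP' eM' : InfinitePlace k → ℤ)
    (K : Subgroup (GA W)) (hK : IsCompactOpenIn W (finitePart W) K)
    {τ : ℕ → Set (GA W → ℂ)} {φ : ℕ → GA W → ℂ} {n : ℕ → ℕ}
    (hB : (Setting.ofAdelicData W R μ DG fdG compG compT compT').IsAdaptedONB τ φ n)
    {f₁ f₂ : GA W → ℂ} (h₁ : IsTestFn W f₁) (h₂ : IsTestFn W f₂)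
    (hst₁ : ∀ j, rightRegular W μ (RTF.cj f₁) (φ j) ∈
      kTypeSpace' W q g g' eP' eM' K (Submodule.span ℂ (τ (n j))))
    (hst₂ : ∀ j, rightRegular W μ (RTF.refl f₂) (φ j) ∈
      kTypeSpace' W q g g' eP' eM' K (Submodule.span ℂ (τ (n j))))
    (hadm : ∀ m, (Setting.ofAdelicData W R μ DG fdG compG compT compT').Hit (RTF.cj f₁) (τ m) →
      IsAdmissibleS W (Setting.ofAdelicData W R μ DG fdG compG compT compT') q g g' w₀ eP eM eP' eM'
        (Submodule.span ℂ (τ m)))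
    (hJ : R.Jc ((Setting.ofAdelicData W R μ DG fdG compG compT compT').conv (RTF.cj f₁) (RTF.cj f₂)) ≠ 0) :
    ∃ V₀ : Submodule ℂ (GA W → ℂ),
      IsAdmissibleS W (Setting.ofAdelicData W R μ DG fdG compG compT compT') q g g' w₀ eP eM eP' eM' V₀ ∧
      ∃ K₀ : Subgroup (GA W), IsCompactOpenIn W (finitePart W) K₀ ∧
        (∃ f ∈ kTypeSpace' W q g g' eP' eM' K₀ V₀,
          periodLin W R.μT' R.DT' R.chi' (restrictTo W (torusT' W) f) ≠ 0) ∧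
        ∃ f ∈ kTypeSpace' W q g g' eP' eM' K₀ V₀,
          periodLin W R.μT R.DT R.chi (restrictTo W (torusT W) f) ≠ 0 := by
  set S := Setting.ofAdelicData W R μ DG fdG compG compT compT' with hS
  haveI := t2Space_GA W
  have h₁' : RTF.IsTest f₁ := ⟨h₁.1, h₁.2⟩
  have h₂' : RTF.IsTest f₂ := ⟨h₂.1, h₂.2⟩
  have hconv' : IsTestFn W (S.conv (RTF.cj f₁) (RTF.cj f₂)) :=
    ⟨(S.conv_isTest h₁'.cj h₂'.cj).1.cont, (S.conv_isTest h₁'.cj h₂'.cj).1.compact⟩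
  -- the RTF distribution of the conjugate characters at `f₁ ⋆ f₂` is non-zero
  have hJ' : S.J (fun t => conj (R.chi t)) (fun t => conj (R.chi' t)) (S.conv f₁ f₂) ≠ 0 := by
    rw [J_conj_eq W R μ DG fdG compG compT compT', ← conv_cj W R μ DG fdG compG compT compT',
      ← Jc_eq_J W R μ DG fdG compG compT compT' hc hc' hconv']
    intro h0
    apply hJ
    have := congrArg conj h0
    rw [Complex.conj_conj, map_zero] at this
    exact this
  -- a non-zero block, then a non-zero term
  obtain ⟨m, hm⟩ := S.exists_specBlock_ne_zero (fun t => conj (R.chi t)) (fun t => conj (R.chi' t)) φ n f₁ f₂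
    (isCharacter_conj_chi W R μ DG fdG compG compT compT' hc hu)
    (isCharacter'_conj_chi' W R μ DG fdG compG compT compT' hc' hunit') hB h₁' h₂' hJ'
  obtain ⟨j, hnj, hterm⟩ := S.exists_specTerm_ne_zero_of_specBlock_ne_zero _ _ φ n f₁ f₂ hm
  have hterm' := hterm
  unfold RTF.Setting.specTerm at hterm'
  have hP' : S.periodT' (fun t => conj (R.chi' t)) (fun t' => S.R (RTF.refl f₂) (φ j) t') ≠ 0 :=
    left_ne_zero_of_mul hterm'
  have hP : S.periodT (fun t => conj (R.chi t)) (fun t => S.R (RTF.cj f₁) (φ j) t) ≠ 0 := by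
    intro h0
    apply right_ne_zero_of_mul hterm'
    rw [h0, map_zero]
  have hhit : S.Hit (RTF.cj f₁) (τ (n j)) := (S.atoms hB h₁' h₂' j hterm).2.2
  have hc₁ : Continuous (S.R (RTF.cj f₁) (φ j)) :=
    (hB.inv (n j)).cont _ ((hB.inv (n j)).conv (φ j) (hB.mem j) _ h₁'.cj)
  have hc₂ : Continuous (S.R (RTF.refl f₂) (φ j)) :=
    (hB.inv (n j)).cont _ ((hB.inv (n j)).conv (φ j) (hB.mem j) _ h₂'.refl)
  refine ⟨Submodule.span ℂ (τ (n j)), hadm (n j) hhit, K, hK,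
    ⟨rightRegular W μ (RTF.refl f₂) (φ j), hst₂ j, ?_⟩, ⟨rightRegular W μ (RTF.cj f₁) (φ j), hst₁ j, ?_⟩⟩
  · rw [← R_ofAdelicData_eq W R μ DG fdG compG compT compT',
      periodLin_chi'_eq_periodT'_conj W R μ DG fdG compG compT compT' hc' hc₂]
    exact hP'
  · rw [← R_ofAdelicData_eq W R μ DG fdG compG compT compT',
      periodLin_chi_eq_periodT_conj W R μ DG fdG compG compT compT' hc hc₁]
    exact hP

end Wall

end Summit.Ventures.HodgeRepro.Tier4.Line4

end
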